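import Literature.MathematicalPhysics.QuantumFieldTheory.Balaban1983to89.T3AlphaInputsACTwoRun
import Literature.MathematicalPhysics.QuantumFieldTheory.Balaban1983to89.T3OneStepAveragingPlaquettes
import HarnessLib

/-!
# Route `UnitScaleTilt` — crux K1bR-pr `FluctuationComparisonRegPr` (stmt-QuantumFields-19201), v5c stub `stub_levelCauchyOfSchemas` (S-E″): first consumer
# lemmas of the two-run module `T3AlphaInputsACTwoRun` — the canonical matched background `coarsenField` IS one descent step, is measurable, and keeps
# small plaquettes small (support file `--supports stmt-QuantumFields-19201`; the stub stays open)

Fleet lead `ym-ust-19201-p2` (gen 0).  `coarsenField F K U′ = descendTo F ℰp K (K+1) _ U′` (`T3OneStepAveragingPlaquettes.descendTo_succ`), hence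
`Measurable (coarsenField F K)` (`measurable_descendTo`) and `PlaqSmall a U′ ⇒ PlaqSmall ((L² + 6(5L)²)·a) (coarsenField F K U′)` for `(25L²/4)·a < δ₂`
(`plaqSmall_descendTo_succ`, [Balaban1985Averaging] Prop. 1) — the plaquette guard of `PtermLipschitz` for the coarsened run-`(K+1)` minimiser in the S-E″ plan
(HANDOFF «The next proof»).  WHAT THIS IS NOT: no estimate on the interaction terms.

References: T. Bałaban, CMP 98 (1985) 17–51 [Balaban1985Averaging] (Prop. 1 (51) p.26); CMP 109 (1987) [Balaban1987RG1] ((0.11) p.253).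
-/

noncomputable section

open MeasureTheory
open Literature.MathematicalPhysics.QuantumFieldTheory.Balaban1983to89
open Literature.MathematicalPhysics.QuantumFieldTheory.Balaban1983to89.T3ContinuumYM3Torus
open Literature.MathematicalPhysics.QuantumFieldTheory.Balaban1983to89.T3UnitLawDensityEML (ℰp measurableE_ℰp)
open Literature.MathematicalPhysics.QuantumFieldTheory.Balaban1983to89.T3TiltDescent
open Literature.MathematicalPhysics.QuantumFieldTheory.Balaban1983to89.T3LevelShift
open Literature.MathematicalPhysics.QuantumFieldTheory.Balaban1983to89.T3OneStepAveragingPlaquettes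
open Literature.MathematicalPhysics.QuantumFieldTheory.Balaban1983to89.T3AlphaInputsACTwoRun
open Literature.MathematicalPhysics.QuantumFieldTheory.Balaban1983to89.ExpMeanLog (deltaSU)

namespace Summit.QuantumFields.YangMills.Theorems.LogComparisonTwoRunGeometry

variable (F : T3Family) (K : ℕ)

/-- **THE CANONICAL MATCHED BACKGROUND IS ONE DESCENT STEP**: `coarsenField F K U′ = D_{K,K+1} U′`. [cite: Balaban1987RG1, (0.11) p.253] -/
theorem coarsenField_eq_descendTo (U' : GaugeField (F.P (K + 1)) 0 (Matrix.specialUnitaryGroup (Fin 2) ℂ)) :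
    coarsenField F K U' = descendTo F ℰp K (K + 1) (Nat.le_succ K) U' := by
  rw [descendTo_succ]
  rfl

/-- Measurability of the canonical matched background. [cite: Balaban1987RG1, (0.11) p.253] -/
theorem measurable_coarsenField : Measurable (coarsenField F K) := by
  have h : coarsenField F K = descendTo F ℰp K (K + 1) (Nat.le_succ K) := funext (coarsenField_eq_descendTo F K)
  rw [h]
  exact measurable_descendTo F (ℰ := ℰp) measurableE_ℰp (Nat.le_succ K)

/-- **SMALL PLAQUETTES STAY SMALL UNDER THE MATCHED-BACKGROUND MAP**: `PlaqSmall a U′`, `0 ≤ a`, `(25L²/4)·a < δ₂` ⇒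
`PlaqSmall ((L² + 6(5L)²)·a) (coarsenField F K U′)` — the plaquette guard of `PtermLipschitz` for the coarsened run-`(K+1)` field.
[cite: Balaban1985Averaging, Prop. 1 (51) p.26] -/
theorem plaqSmall_coarsenField {a : ℝ} (ha : 0 ≤ a) {U' : GaugeField (F.P (K + 1)) 0 (Matrix.specialUnitaryGroup (Fin 2) ℂ)}
    (hU : PlaqSmall a U') (ht : ((((3 + 2) * F.L : ℕ) : ℝ) ^ 2 / 4) * a < deltaSU (Fin 2)) :
    PlaqSmall (((F.L : ℝ) ^ 2 + 6 * (((3 + 2) * F.L : ℕ) : ℝ) ^ 2) * a) (coarsenField F K U') := by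
  rw [coarsenField_eq_descendTo]
  exact plaqSmall_descendTo_succ F K ha hU ht

end Summit.QuantumFields.YangMills.Theorems.LogComparisonTwoRunGeometry

end
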